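import Summits.BirchSwinnertonDyer.BirchSwinnertonDyer.Theorems.UniversalToricDescentHessianTwinSemistableTypesAtThree
import Summits.BirchSwinnertonDyer.BirchSwinnertonDyer.Theorems.UniversalToricDescentHessianTwinMultTypesAtThree
import Summits.BirchSwinnertonDyer.Rank1Residual.WAll.TargetAdditiveAtThreeWildTwinSlices
import HarnessLib

/-!
# Route `UniversalToricDescent` (crux #3, items 20695/20694): THE TWIN CELL BY `3`-ADIC TYPE — on the six Hessian types a wild curve with onto mod-`3` image always has a semistable onto twin, so the twin leaf covers the onto leaf there (PROVED)

Cell `bsd-wall` (W-ALL lane 3, row 2·3@3), seat `bsd-wall-utd-p2` g7 (LEAD on 20695), 2026-08-28.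
`--supports stmt-BirchSwinnertonDyer-20695`. One-screen glue over the four Hessian files (p583681, p584790/p585616,
p585621): the disjunction of the `3`-adic types on which the Hessian `D(0:1)` is a semistable twin —
  `(v₃c₄ = 4 ∧ v₃c₆ ≥ 7)` [good supersingular, `a₃ = 0`; bucket C] ∨ `(v₃c₄ ≥ 4 ∧ v₃c₆ = 6)` [good ordinary or
  multiplicative; (4,6,9), (4,6,≥10), (≥5,6,9)] ∨ `(v₃c₄ ≥ 3 ∧ v₃c₆ = 4)` [(k,4,5)] ∨ `(v₃c₄ ≥ 6 ∧ v₃c₆ = 8)` [(6,8,13)]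
— displayed INLINE (no definition), and two consequences BY NAME:
* `exists_semistable_surj_twin_of_hessianType`: on the types, an onto wild curve HAS a globally minimal `3`-congruent
  twin, not additive at `3`, with onto image (the existential hypothesis of the leaf `WAllExclAddWildRankOneSurjTwin`);
* `bsdp_three_on_hessianType_of_surjTwin`: the twin leaf `WAllExclAddWildRankOneSurjTwin` ALONE gives `BSD₃` for every
  cell curve (non-CM, `ClassO6`, `r_an = 1`, onto) of these types — the twinless leaf `WAllExclAddWildRankOneSurjTwinless`
  contributes nothing there (census: the six types carry all `2 023` twin-having classes except `57` A-classes of types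
  `(5,8,12)`, `(k,3,3)`; utd-idea g9 LENS-MEMO v11 §6).
HONEST FRAMING: glue; nothing closes; no statement item filed (D-0014); BSD is not proved for any curve.
-/

set_option autoImplicit false
set_option linter.dupNamespace false

noncomputable section

namespace Summit.BirchSwinnertonDyer.BirchSwinnertonDyer.Theorems.UniversalToricDescentHessianTwin

open WeierstrassCurve
  Literature.NumberTheory.EllipticCurves
  Literature.NumberTheory.EllipticCurves.Rank1Residual
  Summit.BirchSwinnertonDyer.Rank1Residual
  Summit.BirchSwinnertonDyer.BirchSwinnertonDyer.Theorems.UniversalToricDescentTwinChoice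

/-- **TWIN CELL BY TYPE.** On the six Hessian types (displayed inline) a globally minimal elliptic `W/ℚ` with onto
mod-`3` image has a globally minimal `3`-congruent twin, NOT additive at `3`, with onto image — a global minimal
model of its Hessian member `D(0:1)`. [folklore] -/
theorem exists_semistable_surj_twin_of_hessianType (W : WeierstrassCurve ℚ) [W.IsElliptic] [W.IsGloballyMinimal]
    (htype : (padicValRat 3 W.c₄ = 4 ∧ 7 ≤ padicValRat 3 W.c₆) ∨ (4 ≤ padicValRat 3 W.c₄ ∧ padicValRat 3 W.c₆ = 6) ∨
      (3 ≤ padicValRat 3 W.c₄ ∧ padicValRat 3 W.c₆ = 4) ∨ (6 ≤ padicValRat 3 W.c₄ ∧ padicValRat 3 W.c₆ = 8))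
    (hs : W.HasSurjectiveModNGaloisRep 3) :
    ∃ (W' : WeierstrassCurve ℚ) (_ : W'.IsElliptic) (_ : W'.IsGloballyMinimal),
      O6.ModPCongruent W' W 3 ∧ ¬ Addv W' 3 ∧ W'.HasSurjectiveModNGaloisRep 3 := by
  rcases htype with ⟨h4, h7⟩ | ⟨h4, h6⟩ | ⟨h3, h4⟩ | ⟨h6, h8⟩
  · obtain ⟨W', i1, i2, hc, -, -, hna, hs'⟩ := exists_goodSS_apZero_surj_twin_of_padicValRat W h4 h7 hs
    exact ⟨W', i1, i2, hc, hna, hs'⟩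
  · exact exists_semistable_surj_twin_of_padicValRat W h4 h6 hs
  · exact exists_semistable_surj_twin_of_padicValRat_three_four W h3 h4 hs
  · exact exists_semistable_surj_twin_of_padicValRat_six_eight W h6 h8 hs

/-- **On the Hessian types the TWIN LEAF covers the onto leaf**: `WAllExclAddWildRankOneSurjTwin` alone gives
`BSD₃(E)` for every non-CM wild cell curve `E` (`ClassO6`, `r_an = 1`, `ρ̄₃` onto) of one of the six types — its
existential twin hypothesis is discharged by the Hessian; the twinless leaf is idle there. [folklore] -/
theorem bsdp_three_on_hessianType_of_surjTwin (hT : Summit.BirchSwinnertonDyer.WAllExclAddWildRankOneSurjTwin) :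
    ∀ (W : WeierstrassCurve ℚ) [W.IsElliptic] [W.IsGloballyMinimal], ¬ W.HasCM → Additive.ClassO6 W 3 →
      W.analyticRank = 1 → W.HasSurjectiveModNGaloisRep 3 →
      ((padicValRat 3 W.c₄ = 4 ∧ 7 ≤ padicValRat 3 W.c₆) ∨ (4 ≤ padicValRat 3 W.c₄ ∧ padicValRat 3 W.c₆ = 6) ∨
        (3 ≤ padicValRat 3 W.c₄ ∧ padicValRat 3 W.c₆ = 4) ∨ (6 ≤ padicValRat 3 W.c₄ ∧ padicValRat 3 W.c₆ = 8)) →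
      BSDp W 3 :=
  fun W _ _ hcm hO6 hr hs htype ↦ hT W hcm hO6 hr hs (exists_semistable_surj_twin_of_hessianType W htype hs)

end Summit.BirchSwinnertonDyer.BirchSwinnertonDyer.Theorems.UniversalToricDescentHessianTwin

end
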